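import Mathlib.Analysis.Calculus.Deriv.MeanValue
import Mathlib.Analysis.SpecialFunctions.Sqrt
import Mathlib.Analysis.SpecialFunctions.Trigonometric.Deriv
import Mathlib.Analysis.SpecialFunctions.Log.Deriv
import Mathlib.MeasureTheory.Integral.IntervalIntegral.FundThmCalculus
import Mathlib.NumberTheory.Harmonic.Bounds
import Mathlib.Analysis.Real.Pi.Bounds

/-!
# Beta / EriceFlowEnclosureCesaroTauberianSeqRateSharp — THE SQUARE ROOT IS SHARP FOR SEQUENCES TOO: `a_n = cos(2√n)∕√n` is
# (3∕2)-log-Lipschitz, its Cesàro means are `O((1 + log n)∕n)` (exponent 1 up to a logarithm), and `√n·a_n = cos(2√n)` does NOT tend to 0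
# (along the squares it is `cos 2k`, and `cos 2k → 0` would force `sin 2k → 0` by the addition formula) — so the deviation exponent is EXACTLY 1∕2,
# one half of the Cesàro exponent: the halving of P2 #53d `sqrt_law` ∕ `power_rate` cannot be improved (pure [folklore] toy; Mathlib only —
# the discrete twin at ∞ of rows L113 ∕ L123's witness V(t) = √t·cos((√t)⁻¹)).
# (β-flow team, prover 2 = lower ∕ positivity side, unit `b2b-balaban-beta-bflow-p2`, gen 36; module P2 #53h; no Erice sentence occurs)

HONEST FRAMING (page 1 of everything the β sub-cell writes): discharging `BetaPertH` makes Bałaban's UV stability UNCONDITIONAL — a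
real constructive-QFT result; it is NOT the continuum limit and NOT the Clay problem.  HONEST DEPENDENCY (cell reorg 2026-08-19,
verbatim): «continuum YM on T⁴ ⇐ BetaPertH ∧ nine spine estimates (0/9 proved); BetaPertH ⇐ (D1) ∧ (D4) ∧ CAP+tail; G-an2-4 gates
asym, D1 and NE2/3/4.»  THIS MODULE DISCHARGES NOTHING and quotes nothing: an explicit [folklore] sequence (a TOY of ours, not a β-function).

THE POINT.  V(x) := cos(2√x)∕√x has `V′(x) = −sin(2√x)∕x − cos(2√x)∕(2x√x)`, `|V′| ≤ 3∕(2x)` on [1, ∞), so `x ↦ (3∕2)log x ± V(x)` are monotone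
there and `|V x − V y| ≤ (3∕2)log(x∕y)` for 1 ≤ y ≤ x; `∫₁ⁿ V = sin(2√n) − sin 2` (antiderivative sin(2√x)), and each cell differs from the
sample by at most `(3∕2)log((i+1)∕i) ≤ (3∕2)∕i`, so `|Σ_{i<n} a_i| ≤ 2 + (3∕2)(1 + log n)` — a harmonic sum again.

WHAT THIS FILE PROVES (0 sorry, 0 def): §1 `hasDerivAt_V`, `deriv_V_abs_le`, `V_logLip`, `V_continuousOn`; §2 `hasDerivAt_sin_two_sqrt`,
`integral_V`, `cell_le`, **`sum_abs_le`**, **`cesaro_abs_le`**; §3 `cos_two_mul_nat_not_tendsto_zero`, **`not_littleO_sqrt`**;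
§4 END **`sqrt_law_sharp`** (the hypotheses of P2 #53d `sqrt_law` with K = 3∕2, τ = 0 and Cesàro bound `4(1 + log 3N)∕N` on [N, 3N] at every
N ≥ 1, and `¬ (√n·a_n → 0)`).
NOT CLAIMED: anything about β-functions (no β has this r∕u² — the continuum-side dressing of rows L113 ∕ L123 is not repeated); `BetaPertH`; Clay.
-/

namespace Summit.QuantumFields.BalabanUV.Beta.EriceFlowEnclosureCesaroTauberianSeqRateSharp

open Set Filter Topology Finset MeasureTheory intervalIntegral

noncomputable section

/-! ## §1 The witness V(x) = cos(2√x)∕√x: derivative, log-Lipschitz bound -/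

/-- `V′(x) = −sin(2√x)∕x − cos(2√x)∕(2x√x)` for x > 0, written as `−sin(2√x)·(1∕√x)·(1∕√x) + cos(2√x)·(−(1∕(2√x))∕(√x)²)·…`; we state the
derivative in the form the chain∕quotient rules produce and simplify afterwards. [folklore] -/
theorem hasDerivAt_V {x : ℝ} (hx : 0 < x) :
    HasDerivAt (fun y => Real.cos (2 * Real.sqrt y) / Real.sqrt y)
      ((-Real.sin (2 * Real.sqrt x) * (2 * (1 / (2 * Real.sqrt x))) * Real.sqrt x
          - Real.cos (2 * Real.sqrt x) * (1 / (2 * Real.sqrt x))) / (Real.sqrt x) ^ 2) x := by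
  have hs : HasDerivAt (fun y => Real.sqrt y) (1 / (2 * Real.sqrt x)) x := Real.hasDerivAt_sqrt hx.ne'
  have h2 : HasDerivAt (fun y => 2 * Real.sqrt y) (2 * (1 / (2 * Real.sqrt x))) x := hs.const_mul 2
  have hcos : HasDerivAt (fun y => Real.cos (2 * Real.sqrt y)) (-Real.sin (2 * Real.sqrt x) * (2 * (1 / (2 * Real.sqrt x)))) x :=
    (Real.hasDerivAt_cos _).comp x h2
  have hsx : Real.sqrt x ≠ 0 := (Real.sqrt_pos.mpr hx).ne'
  exact hcos.div hs hsx

/-- `|V′(x)| ≤ 3∕(2x)` for x ≥ 1. [folklore] -/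
theorem deriv_V_abs_le {x : ℝ} (hx : 1 ≤ x) :
    |(-Real.sin (2 * Real.sqrt x) * (2 * (1 / (2 * Real.sqrt x))) * Real.sqrt x
          - Real.cos (2 * Real.sqrt x) * (1 / (2 * Real.sqrt x))) / (Real.sqrt x) ^ 2| ≤ 3 / (2 * x) := by
  have hx0 : 0 < x := by linarith
  have hs : 0 < Real.sqrt x := Real.sqrt_pos.mpr hx0
  have hs1 : 1 ≤ Real.sqrt x := by rw [← Real.sqrt_one]; exact Real.sqrt_le_sqrt hx
  have hsq : (Real.sqrt x) ^ 2 = x := Real.sq_sqrt hx0.le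
  have hsin := Real.abs_sin_le_one (2 * Real.sqrt x)
  have hcos := Real.abs_cos_le_one (2 * Real.sqrt x)
  -- simplify the numerator: −sin(2√x) − cos(2√x)∕(2√x)
  have hnum : (-Real.sin (2 * Real.sqrt x) * (2 * (1 / (2 * Real.sqrt x))) * Real.sqrt x
          - Real.cos (2 * Real.sqrt x) * (1 / (2 * Real.sqrt x)))
        = -Real.sin (2 * Real.sqrt x) - Real.cos (2 * Real.sqrt x) / (2 * Real.sqrt x) := by
    field_simp
  rw [hnum, hsq, abs_div, abs_of_pos hx0]
  -- |−sin − cos∕(2√x)| ≤ 1 + 1∕2 = 3∕2 (as √x ≥ 1), and |num|∕x ≤ (3∕2)∕x = 3∕(2x)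
  have h1 : |Real.cos (2 * Real.sqrt x) / (2 * Real.sqrt x)| ≤ 1 / 2 := by
    rw [abs_div, abs_of_pos (by positivity : (0:ℝ) < 2 * Real.sqrt x), div_le_iff₀ (by positivity)]
    nlinarith [abs_nonneg (Real.cos (2 * Real.sqrt x))]
  have h2 : |-Real.sin (2 * Real.sqrt x) - Real.cos (2 * Real.sqrt x) / (2 * Real.sqrt x)| ≤ 3 / 2 := by
    calc _ ≤ |-Real.sin (2 * Real.sqrt x)| + |Real.cos (2 * Real.sqrt x) / (2 * Real.sqrt x)| := abs_sub _ _
      _ ≤ 1 + 1 / 2 := by rw [abs_neg]; exact add_le_add hsin h1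
      _ = 3 / 2 := by norm_num
  rw [div_le_div_iff₀ hx0 (by positivity)]
  nlinarith [abs_nonneg (-Real.sin (2 * Real.sqrt x) - Real.cos (2 * Real.sqrt x) / (2 * Real.sqrt x))]

/-- V is continuous on ]0, ∞[ (hence on [1, ∞)). [folklore] -/
theorem V_continuousOn : ContinuousOn (fun y => Real.cos (2 * Real.sqrt y) / Real.sqrt y) (Ici 1) :=
  fun _ hx => (hasDerivAt_V (lt_of_lt_of_le one_pos hx)).continuousAt.continuousWithinAt

/-- **V IS (3∕2)-LOG-LIPSCHITZ ON [1, ∞)**: `|V x − V y| ≤ (3∕2)·log(x∕y)` for `1 ≤ y ≤ x` (the functions `(3∕2)log ± V` are monotone on [1, ∞)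
since their derivatives `3∕(2x) ± V′(x)` are non-negative). [folklore] -/
theorem V_logLip {x y : ℝ} (hy : 1 ≤ y) (hyx : y ≤ x) :
    |Real.cos (2 * Real.sqrt x) / Real.sqrt x - Real.cos (2 * Real.sqrt y) / Real.sqrt y| ≤ 3 / 2 * Real.log (x / y) := by
  have hx : 1 ≤ x := hy.trans hyx
  have hy0 : 0 < y := by linarith
  have hx0 : 0 < x := by linarith
  -- monotonicity of F± := (3/2) log ± V on [1, ∞)
  have hmono : ∀ σ : ℝ, σ = 1 ∨ σ = -1 →
      MonotoneOn (fun t => 3 / 2 * Real.log t + σ * (Real.cos (2 * Real.sqrt t) / Real.sqrt t)) (Ici 1) := by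
    intro σ hσ
    have hσ1 : |σ| = 1 := by rcases hσ with h | h <;> simp [h]
    apply monotoneOn_of_deriv_nonneg (convex_Ici 1)
    · refine ContinuousOn.add ?_ (V_continuousOn.const_smul σ |>.congr fun t _ => by simp [smul_eq_mul])
      exact ContinuousOn.mul continuousOn_const
        (Real.continuousOn_log.mono fun t (ht : 1 ≤ t) => ne_of_gt (lt_of_lt_of_le one_pos ht))
    · intro t ht
      rw [interior_Ici] at ht
      have ht0 : 0 < t := lt_trans one_pos ht
      have hd : HasDerivAt (fun t => 3 / 2 * Real.log t + σ * (Real.cos (2 * Real.sqrt t) / Real.sqrt t))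
          (3 / 2 * t⁻¹ + σ * ((-Real.sin (2 * Real.sqrt t) * (2 * (1 / (2 * Real.sqrt t))) * Real.sqrt t
            - Real.cos (2 * Real.sqrt t) * (1 / (2 * Real.sqrt t))) / Real.sqrt t ^ 2)) t :=
        ((Real.hasDerivAt_log ht0.ne').const_mul (3 / 2)).add ((hasDerivAt_V ht0).const_mul σ)
      exact hd.differentiableAt.differentiableWithinAt
    · intro t ht
      rw [interior_Ici] at ht
      have ht1 : 1 ≤ t := le_of_lt ht
      have ht0 : 0 < t := lt_trans one_pos ht
      have hd : HasDerivAt (fun t => 3 / 2 * Real.log t + σ * (Real.cos (2 * Real.sqrt t) / Real.sqrt t))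
          (3 / 2 * t⁻¹ + σ * ((-Real.sin (2 * Real.sqrt t) * (2 * (1 / (2 * Real.sqrt t))) * Real.sqrt t
            - Real.cos (2 * Real.sqrt t) * (1 / (2 * Real.sqrt t))) / Real.sqrt t ^ 2)) t :=
        ((Real.hasDerivAt_log ht0.ne').const_mul (3 / 2)).add ((hasDerivAt_V ht0).const_mul σ)
      rw [hd.deriv]
      have hb := deriv_V_abs_le ht1
      have hkey : |σ * ((-Real.sin (2 * Real.sqrt t) * (2 * (1 / (2 * Real.sqrt t))) * Real.sqrt t
          - Real.cos (2 * Real.sqrt t) * (1 / (2 * Real.sqrt t))) / Real.sqrt t ^ 2)| ≤ 3 / (2 * t) := by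
        rw [abs_mul, hσ1, one_mul]; exact hb
      have h32 : 3 / 2 * t⁻¹ = 3 / (2 * t) := by field_simp
      rw [h32]
      linarith [(abs_le.mp hkey).1]
  have hplus := hmono 1 (Or.inl rfl) (show (1:ℝ) ≤ y from hy) (show (1:ℝ) ≤ x from hx) hyx
  have hminus := hmono (-1) (Or.inr rfl) (show (1:ℝ) ≤ y from hy) (show (1:ℝ) ≤ x from hx) hyx
  simp only [one_mul, neg_one_mul] at hplus hminus
  rw [Real.log_div hx0.ne' hy0.ne', abs_le]
  constructor <;> linarith

/-! ## §2 The Cesàro means: `∫₁ⁿ V = sin(2√n) − sin 2` and the cell comparison -/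

/-- `d∕dx sin(2√x) = V(x)` for x > 0. [folklore] -/
theorem hasDerivAt_sin_two_sqrt {x : ℝ} (hx : 0 < x) :
    HasDerivAt (fun y => Real.sin (2 * Real.sqrt y)) (Real.cos (2 * Real.sqrt x) / Real.sqrt x) x := by
  have hs : HasDerivAt (fun y => Real.sqrt y) (1 / (2 * Real.sqrt x)) x := Real.hasDerivAt_sqrt hx.ne'
  have h := (Real.hasDerivAt_sin _).comp x (hs.const_mul 2)
  have hsx : Real.sqrt x ≠ 0 := (Real.sqrt_pos.mpr hx).ne'
  have heq : Real.cos (2 * Real.sqrt x) * (2 * (1 / (2 * Real.sqrt x))) = Real.cos (2 * Real.sqrt x) / Real.sqrt x := by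
    field_simp
  rwa [heq] at h

/-- `∫_a^b V = sin(2√b) − sin(2√a)` for `1 ≤ a ≤ b` (FTC; V continuous on [1, ∞)). [folklore] -/
theorem integral_V {a b : ℝ} (ha : 1 ≤ a) (hab : a ≤ b) :
    ∫ y in a..b, Real.cos (2 * Real.sqrt y) / Real.sqrt y = Real.sin (2 * Real.sqrt b) - Real.sin (2 * Real.sqrt a) := by
  apply integral_eq_sub_of_hasDerivAt
  · intro y hy
    rw [uIcc_of_le hab] at hy
    exact hasDerivAt_sin_two_sqrt (lt_of_lt_of_le one_pos (ha.trans hy.1))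
  · exact (V_continuousOn.mono fun y hy => by
      rw [uIcc_of_le hab] at hy; exact ha.trans hy.1).intervalIntegrable

/-- THE CELL COMPARISON: for i ≥ 1, `|a_i − ∫_i^{i+1} V| ≤ (3∕2)∕i` (every value on the cell is within `(3∕2)log((i+1)∕i) ≤ (3∕2)∕i` of a_i). [folklore] -/
theorem cell_le {i : ℕ} (hi : 1 ≤ i) :
    |Real.cos (2 * Real.sqrt i) / Real.sqrt i - ∫ y in (i:ℝ)..(i:ℝ) + 1, Real.cos (2 * Real.sqrt y) / Real.sqrt y| ≤ 3 / 2 / i := by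
  have hi1 : (1:ℝ) ≤ i := by exact_mod_cast hi
  have hi0 : (0:ℝ) < i := by linarith
  -- write a_i as the integral of the constant over the unit cell
  have hconst : (∫ _y in (i:ℝ)..(i:ℝ) + 1, Real.cos (2 * Real.sqrt i) / Real.sqrt i) = Real.cos (2 * Real.sqrt i) / Real.sqrt i := by
    rw [intervalIntegral.integral_const]; simp
  have hint : IntervalIntegrable (fun y => Real.cos (2 * Real.sqrt y) / Real.sqrt y) volume (i:ℝ) ((i:ℝ) + 1) :=
    (V_continuousOn.mono fun y hy => by
      rw [uIcc_of_le (by linarith : (i:ℝ) ≤ i + 1)] at hy; exact hi1.trans hy.1).intervalIntegrable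
  rw [← hconst, ← intervalIntegral.integral_sub intervalIntegrable_const hint]
  have hbound : ∀ y ∈ Set.uIoc (i:ℝ) ((i:ℝ) + 1),
      ‖Real.cos (2 * Real.sqrt i) / Real.sqrt i - Real.cos (2 * Real.sqrt y) / Real.sqrt y‖ ≤ 3 / 2 / i := by
    intro y hy
    rw [uIoc_of_le (by linarith : (i:ℝ) ≤ i + 1)] at hy
    rw [Real.norm_eq_abs, abs_sub_comm]
    calc _ ≤ 3 / 2 * Real.log (y / i) := V_logLip hi1 hy.1.le
      _ ≤ 3 / 2 * (y / i - 1) := by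
          apply mul_le_mul_of_nonneg_left _ (by norm_num)
          exact Real.log_le_sub_one_of_pos (div_pos (by linarith [hy.1]) hi0)
      _ ≤ 3 / 2 / i := by
          rw [div_sub_one hi0.ne']
          have hyi : (y - i) / (i:ℝ) ≤ 1 / i := div_le_div_of_nonneg_right (by linarith [hy.2]) hi0.le
          calc 3 / 2 * ((y - (i:ℝ)) / i) ≤ 3 / 2 * (1 / i) := mul_le_mul_of_nonneg_left hyi (by norm_num)
            _ = 3 / 2 / i := by ring
  have h := intervalIntegral.norm_integral_le_of_norm_le_const hbound
  rw [Real.norm_eq_abs] at h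
  simpa using h

/-- **THE PARTIAL SUMS ARE LOGARITHMIC**: for n ≥ 1, `|Σ_{i<n} a_i| ≤ 2 + (3∕2)(1 + log n)` (a_0 = 0 in Lean's conventions; `Σ_{1≤i<n} ∫_i^{i+1} V =
sin(2√n) − sin 2`; the cell errors sum to at most (3∕2)·harmonic). [folklore] -/
theorem sum_abs_le {n : ℕ} (hn : 1 ≤ n) :
    |∑ i ∈ range n, Real.cos (2 * Real.sqrt i) / Real.sqrt i| ≤ 2 + 3 / 2 * (1 + Real.log n) := by
  -- split off i = 0 (value 0) and compare the rest with the integral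
  have h0 : Real.cos (2 * Real.sqrt ((0:ℕ):ℝ)) / Real.sqrt ((0:ℕ):ℝ) = 0 := by simp
  have hsplit : ∑ i ∈ range n, Real.cos (2 * Real.sqrt i) / Real.sqrt i
      = ∑ i ∈ Finset.Ico 1 n, Real.cos (2 * Real.sqrt i) / Real.sqrt i := by
    rw [← sum_range_add_sum_Ico _ hn, Finset.sum_range_one, h0, zero_add]
  -- the integral over [1, n] as a sum of cell integrals
  have hcells : ∑ i ∈ Finset.Ico 1 n, (∫ y in (i:ℝ)..(i:ℝ) + 1, Real.cos (2 * Real.sqrt y) / Real.sqrt y)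
      = ∫ y in ((1:ℕ):ℝ)..((n:ℕ):ℝ), Real.cos (2 * Real.sqrt y) / Real.sqrt y := by
    have h := intervalIntegral.sum_integral_adjacent_intervals_Ico (a := fun k : ℕ => (k : ℝ)) (μ := volume)
      (f := fun y => Real.cos (2 * Real.sqrt y) / Real.sqrt y) hn ?_
    · simpa [Nat.cast_add, Nat.cast_one] using h
    · intro k hk
      have hk1 : (1:ℝ) ≤ k := by exact_mod_cast hk.1
      exact (V_continuousOn.mono fun y hy => by
        rw [uIcc_of_le (by push_cast; linarith : (k:ℝ) ≤ ((k+1 : ℕ) : ℝ))] at hy; exact hk1.trans hy.1).intervalIntegrable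
  have hint : ∫ y in ((1:ℕ):ℝ)..((n:ℕ):ℝ), Real.cos (2 * Real.sqrt y) / Real.sqrt y
      = Real.sin (2 * Real.sqrt n) - Real.sin (2 * Real.sqrt 1) := by
    rw [Nat.cast_one]; exact integral_V le_rfl (by exact_mod_cast hn)
  -- Σ a_i = ∫ + Σ (a_i − cell)
  have hdecomp : ∑ i ∈ Finset.Ico 1 n, Real.cos (2 * Real.sqrt i) / Real.sqrt i
      = (∫ y in ((1:ℕ):ℝ)..((n:ℕ):ℝ), Real.cos (2 * Real.sqrt y) / Real.sqrt y)
        + ∑ i ∈ Finset.Ico 1 n, (Real.cos (2 * Real.sqrt i) / Real.sqrt i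
            - ∫ y in (i:ℝ)..(i:ℝ) + 1, Real.cos (2 * Real.sqrt y) / Real.sqrt y) := by
    rw [← hcells, ← sum_add_distrib]
    exact sum_congr rfl fun i _ => by ring
  have herr : |∑ i ∈ Finset.Ico 1 n, (Real.cos (2 * Real.sqrt i) / Real.sqrt i
            - ∫ y in (i:ℝ)..(i:ℝ) + 1, Real.cos (2 * Real.sqrt y) / Real.sqrt y)| ≤ 3 / 2 * (1 + Real.log n) := by
    calc _ ≤ ∑ i ∈ Finset.Ico 1 n, |Real.cos (2 * Real.sqrt i) / Real.sqrt i
            - ∫ y in (i:ℝ)..(i:ℝ) + 1, Real.cos (2 * Real.sqrt y) / Real.sqrt y| := abs_sum_le_sum_abs _ _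
      _ ≤ ∑ i ∈ Finset.Ico 1 n, 3 / 2 / (i:ℝ) := sum_le_sum fun i hi => cell_le (Finset.mem_Ico.mp hi).1
      _ = 3 / 2 * ∑ i ∈ Finset.Ico 1 n, ((i:ℝ))⁻¹ := by rw [mul_sum]; exact sum_congr rfl fun i _ => by rw [div_eq_mul_inv]
      _ ≤ 3 / 2 * (1 + Real.log n) := by
          apply mul_le_mul_of_nonneg_left _ (by norm_num)
          -- harmonic bound
          have h2 : ∑ i ∈ Finset.Ico 1 n, ((i : ℝ))⁻¹ = (harmonic (n - 1) : ℝ) := by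
            rw [sum_Ico_eq_sum_range]
            simp only [harmonic, Rat.cast_sum, Rat.cast_inv, Rat.cast_natCast]
            refine sum_congr rfl fun k _ => ?_
            push_cast; ring
          have h3 : (harmonic (n - 1) : ℝ) ≤ 1 + Real.log ((n - 1 : ℕ) : ℝ) := harmonic_le_one_add_log (n - 1)
          have h4 : Real.log ((n - 1 : ℕ) : ℝ) ≤ Real.log n := by
            rcases Nat.eq_zero_or_pos (n - 1) with h0' | hpos
            · rw [h0', Nat.cast_zero, Real.log_zero]; exact Real.log_nonneg (by exact_mod_cast hn)
            · exact Real.log_le_log (by exact_mod_cast hpos) (by exact_mod_cast Nat.sub_le n 1)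
          linarith
  have hsinb : |Real.sin (2 * Real.sqrt n) - Real.sin (2 * Real.sqrt 1)| ≤ 2 := by
    calc _ ≤ |Real.sin (2 * Real.sqrt n)| + |Real.sin (2 * Real.sqrt 1)| := abs_sub _ _
      _ ≤ 1 + 1 := add_le_add (Real.abs_sin_le_one _) (Real.abs_sin_le_one _)
      _ = 2 := by norm_num
  rw [hsplit, hdecomp, hint]
  exact (abs_add_le _ _).trans (add_le_add hsinb herr)

/-- **THE CESÀRO MEANS ARE `O((1 + log n)∕n)`**: for n ≥ 1, `|n⁻¹·Σ_{i<n} a_i| ≤ 4(1 + log n)∕n`. [folklore] -/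
theorem cesaro_abs_le {n : ℕ} (hn : 1 ≤ n) :
    |(n : ℝ)⁻¹ * ∑ i ∈ range n, Real.cos (2 * Real.sqrt i) / Real.sqrt i| ≤ 4 * (1 + Real.log n) / n := by
  have hnpos : 0 < (n : ℝ) := Nat.cast_pos.mpr (lt_of_lt_of_le Nat.one_pos hn)
  have hlog : 0 ≤ Real.log (n : ℝ) := Real.log_nonneg (by exact_mod_cast hn)
  rw [abs_mul, abs_of_pos (inv_pos.mpr hnpos), inv_mul_eq_div, div_le_div_iff_of_pos_right hnpos]
  linarith [sum_abs_le hn]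

/-! ## §3 `cos(2√n)` does not tend to 0 -/

/-- `cos(2k)` (k ∈ ℕ) does NOT tend to 0: otherwise `cos(2(k+1)) → 0` too, and `sin 2k·sin 2 = cos 2k·cos 2 − cos(2k + 2)` would force
`sin 2k → 0`, contradicting `sin² + cos² = 1` (sin 2 > 0). [folklore] -/
theorem cos_two_mul_nat_not_tendsto_zero : ¬ Tendsto (fun k : ℕ => Real.cos (2 * k)) atTop (𝓝 0) := by
  intro h
  have hsin2 : 0 < Real.sin 2 := Real.sin_pos_of_pos_of_lt_pi (by norm_num) (by linarith [Real.pi_gt_three])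
  have hshift : Tendsto (fun k : ℕ => Real.cos (2 * (((k + 1 : ℕ)) : ℝ))) atTop (𝓝 0) :=
    h.comp (tendsto_add_atTop_nat 1)
  -- sin 2k = (cos 2k cos 2 − cos(2k+2)) / sin 2 → 0
  have hsin : Tendsto (fun k : ℕ => Real.sin (2 * k)) atTop (𝓝 0) := by
    have hform : ∀ k : ℕ, Real.sin (2 * k) = (Real.cos (2 * k) * Real.cos 2 - Real.cos (2 * (((k + 1 : ℕ)) : ℝ))) / Real.sin 2 := by
      intro k
      have : (2 : ℝ) * (((k + 1 : ℕ)) : ℝ) = 2 * k + 2 := by push_cast; ring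
      rw [this, Real.cos_add]
      field_simp
      ring
    have hlim := ((h.mul_const (Real.cos 2)).sub hshift).div_const (Real.sin 2)
    rw [zero_mul, sub_zero, zero_div] at hlim
    exact hlim.congr fun k => (hform k).symm
  have hone : Tendsto (fun k : ℕ => Real.sin (2 * k) ^ 2 + Real.cos (2 * k) ^ 2) atTop (𝓝 (0 ^ 2 + 0 ^ 2)) :=
    (hsin.pow 2).add (h.pow 2)
  have hconst : (fun k : ℕ => Real.sin (2 * (k:ℝ)) ^ 2 + Real.cos (2 * (k:ℝ)) ^ 2) = fun _ => 1 :=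
    funext fun k => Real.sin_sq_add_cos_sq _
  rw [hconst] at hone
  have := tendsto_nhds_unique (tendsto_const_nhds) hone
  norm_num at this

/-- **`√n·a_n = cos(2√n)` DOES NOT TEND TO 0** (along the squares n = k² it is cos 2k). [folklore] -/
theorem not_littleO_sqrt :
    ¬ Tendsto (fun n : ℕ => Real.sqrt n * (Real.cos (2 * Real.sqrt n) / Real.sqrt n)) atTop (𝓝 0) := by
  intro h
  have hsq : Tendsto (fun k : ℕ => k ^ 2) atTop atTop :=
    Filter.tendsto_atTop_atTop.mpr fun b => ⟨b, fun k hk => le_trans hk (Nat.le_self_pow two_ne_zero k)⟩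
  have h2 := h.comp hsq
  refine cos_two_mul_nat_not_tendsto_zero (h2.congr' ?_)
  filter_upwards [eventually_ge_atTop 1] with k hk
  have hk0 : (0:ℝ) < k := Nat.cast_pos.mpr (lt_of_lt_of_le Nat.one_pos hk)
  have hsqrt : Real.sqrt (((k ^ 2 : ℕ)) : ℝ) = k := by
    rw [Nat.cast_pow, Real.sqrt_sq hk0.le]
  simp only [Function.comp, hsqrt]
  field_simp

/-! ## §4 END: the square-root law's halving is attained -/

/-- **END — THE HALVING OF P2 #53d IS SHARP FOR SEQUENCES.**  The sequence `a_n := cos(2√n)∕√n` satisfies, at EVERY N ≥ 1, the hypotheses of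
P2 #53d `sqrt_law` with `K = 3∕2`, `τ = 0` and the Cesàro bound `E_N = 4(1 + log 3N)∕N` on the window [N, 3N] (exponent 1 up to a logarithm,
limit m = 0), hence `|a_N| ≲ √((1 + log 3N)∕N)`; and this is the truth: **`√N·a_N = cos(2√N)` does not tend to 0**, so `a_N` is NOT
`o(N^{−1∕2})` — the deviation exponent is EXACTLY one half of the Cesàro exponent. [folklore] -/
theorem sqrt_law_sharp :
    (∀ N i : ℕ, 1 ≤ N → N ≤ i →
        |Real.cos (2 * Real.sqrt i) / Real.sqrt i - Real.cos (2 * Real.sqrt N) / Real.sqrt N| ≤ 3 / 2 * Real.log ((i:ℝ) / N) + 0) ∧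
      (∀ N n : ℕ, 1 ≤ N → N ≤ n → n ≤ 3 * N →
        |(n : ℝ)⁻¹ * ∑ i ∈ range n, Real.cos (2 * Real.sqrt i) / Real.sqrt i - 0| ≤ 4 * (1 + Real.log (3 * (N:ℝ))) / N) ∧
      ¬ Tendsto (fun n : ℕ => Real.sqrt n * (Real.cos (2 * Real.sqrt n) / Real.sqrt n)) atTop (𝓝 0) := by
  refine ⟨fun N i hN hNi => ?_, fun N n hN hNn hn3 => ?_, not_littleO_sqrt⟩
  · rw [add_zero]
    exact V_logLip (by exact_mod_cast hN) (by exact_mod_cast hNi)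
  · rw [sub_zero]
    have hn1 : 1 ≤ n := hN.trans hNn
    have hNpos : 0 < (N : ℝ) := Nat.cast_pos.mpr (lt_of_lt_of_le Nat.one_pos hN)
    have hnpos : 0 < (n : ℝ) := Nat.cast_pos.mpr (lt_of_lt_of_le Nat.one_pos hn1)
    have hn3' : (n : ℝ) ≤ 3 * N := by exact_mod_cast hn3
    have hlogn : 0 ≤ Real.log (n:ℝ) := Real.log_nonneg (by exact_mod_cast hn1)
    have hlogle : Real.log (n:ℝ) ≤ Real.log (3 * (N:ℝ)) := Real.log_le_log hnpos hn3'
    calc _ ≤ 4 * (1 + Real.log n) / n := cesaro_abs_le hn1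
      _ ≤ 4 * (1 + Real.log (3 * (N:ℝ))) / N := by
          rw [div_le_div_iff₀ hnpos hNpos]
          have h1 : 4 * (1 + Real.log (n:ℝ)) * N ≤ 4 * (1 + Real.log (3 * (N:ℝ))) * N := by nlinarith
          have h2 : 4 * (1 + Real.log (3 * (N:ℝ))) * N ≤ 4 * (1 + Real.log (3 * (N:ℝ))) * n := by
            apply mul_le_mul_of_nonneg_left (by exact_mod_cast hNn); nlinarith
          linarith

end

end Summit.QuantumFields.BalabanUV.Beta.EriceFlowEnclosureCesaroTauberianSeqRateSharp
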